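import Literature.Computability.Cryptography.BlumMicaliMachine
import HarnessLib

/-!
# The Blum–Micali reduction on a stack machine, II: candidates, guesses, output

Continuation of `BlumMicaliMachine.lean` (states `encSt`, size bound `Bnd`, the vote, the selector,
the round and the descent as `Com.Impl` implementations of the oracle computations of
`BlumMicaliAlgorithm.lean`). This file climbs the remaining two levels of the reduction behind
the guard:

* `impl_candidate` — the candidate program `candProg` implements `bmCandidateC Q p g y r i`
  (start `w_i = y · g^{-iS}`, the `ℓ`-round descent, the candidate `acc + iS`, the check
  `g^c ≡ y` recording the first verified candidate in `BEST`/`FND`), `28800 (N+1)⁵` steps;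
* `impl_guesses` — the `2q` guesses (`impl_forEach` over `List.range (2q)`), `28803 (N+1)⁶` steps,
  with `bestOf`/`fndOf` (the first verified candidate of a list) tracking `bmOutput`;
* `impl_body` — prologue, guesses and the output `BEST := BEST mod (p - 1)`: `bodyProg`
  implements `forEach (bmCandidateC …) (range 2q) >>= pure ∘ bmOutput p g y` from the initial
  variables `initVars r`, `29300 (N+1)⁶` steps.

The last part (`BlumMicaliMachine3.lean`) adds the parameter phase, parsing and the guard, and
assembles `bmOracleAlg_isPolyTime`.

## References

* M. Blum, S. Micali, *How to generate cryptographically strong sequences of pseudo-random bits*,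
  SIAM J. Comput. 13 (1984) 850–864, §3.3, proof of Theorem 3 (guess the initial segment,
  `n = 2Q(|p|)` guesses, check the candidate by one exponentiation).
* E. Kranakis, *Primality and Cryptography*, Wiley–Teubner 1986, §4.10, Thm. 4.21.
-/

namespace Literature.Computability.Cryptography
namespace BMMachine

open _root_.Computability Complexity Complexity.Com

attribute [local simp] not_or_self_iff'

/-! ### The candidate of a guess -/

section Candidate

variable {Q : Polynomial ℕ} {p g y N : ℕ}

/-- The bound on candidates: `acc + iS < 2^ℓ + 2qS ≤ 2p + 2qS`. [folklore] -/
def candBound (Q : Polynomial ℕ) (p : ℕ) : ℕ := 2 * p + 2 * bmQ Q p * bmSeg Q p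

open NS NOp in
/-- Before the descent of guess `i`: `E := y · (g⁻¹)^{iS} mod p` and load the round counter.
[Blum–Micali 1984, §3.3, proof of Theorem 3, Step 1 (`w_i = y g^{-i(p-1)/n}`)] [folklore] -/
def candPreS : NS O :=
  ofList [.mul (vv .T1) (vv .I) (cc .S), .powMod (vv .T2) (cc .GI) (vv .T1) (cc .P), .copy (cc .Y) (vv .E),
    .mulMod (vv .E) (vv .T2) (cc .P), .clear (vv .T1), .clear (vv .T2), .copy (cc .LU) (vv .CT)]

open NS NOp in
/-- After the descent: the candidate `ACC + iS`, the check `g^{cand} ≡ y`, recording the first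
verified candidate in `BEST` (flag `FND`), clean-up, `I := I + 1`. [Blum–Micali 1984, §3.3,
proof of Theorem 3, Step 3] [folklore] -/
def candPostS : NS O :=
  (ofList [.mul (vv .T1) (vv .I) (cc .S), .add (vv .T2) (vv .ACC) (vv .T1), .powMod (vv .T3) (cc .G) (vv .T2) (cc .P),
    .eq (vv .FQ) (vv .T3) (cc .Y) (vv .FT)]).seq
  ((ite (vv .FQ) (ite (vv .FND) (op (.push (vv .FND) true))
      (ofList [.clear (vv .BEST), .copy (vv .T2) (vv .BEST), .push (vv .FND) true])) nop).seq
    (ofList [.clear (vv .T1), .clear (vv .T2), .clear (vv .T3), .clear (vv .ACC), .clear (vv .E),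
      .const (vv .TP) (encodeNat 1), .succ (vv .I) (vv .I)]))

/-- **The candidate program** of one guess. [Blum–Micali 1984, §3.3, proof of Theorem 3] [folklore] -/
def candProg : Com (EReg ⊕ O) := candPreS.com ;; (loop (ru (Sum.inr .CT)) roundProg roundProg ;; candPostS.com)

/-- The candidate computation as "descent loop, then two pure maps". [folklore] -/
theorem bmCandidateC_eq (Q : Polynomial ℕ) (p g y : ℕ) (r : List Bool) (i : ℕ) :
    bmCandidateC Q p g y r i = OracleComp.bind (OracleComp.bind
      (OracleComp.iterM (bmDescentStepC p g p.size (bmM Q p) (bmK Q p) (bmBlocks r p.size (bmM Q p) (bmK Q p) i))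
        p.size (0, y * (g ^ (p - 2)) ^ (i * bmSeg Q p) % p, 0)) (fun s => OracleComp.pure s.2.2))
      (fun c => OracleComp.pure (c + i * bmSeg Q p)) := rfl

/-- The record of the first verified candidate after one more candidate `c`. [folklore] -/
def bestAfter (p g y : ℕ) (best : ℕ) (fnd : Bool) (c : ℕ) : ℕ :=
  if g ^ c % p = y % p then (if fnd then best else c) else best

/-- The found-flag after one more candidate `c`. [folklore] -/
def fndAfter (p g y : ℕ) (fnd : Bool) (c : ℕ) : Bool := fnd || decide (g ^ c % p = y % p)

/-- **The candidate program implements `bmCandidateC … i`** from the guess-level state: it consumes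
the `ℓ m (k+1)` coins of guess `i`, records the candidate in `BEST`/`FND` if it is the first with
`g^c ≡ y`, and increments `I`. [Blum–Micali 1984, §3.3, proof of Theorem 3]
[cite: BlumMicali1984, Theorem 3 (proof)] -/
theorem impl_candidate (hB : Bnd Q p g y N) {σ : List Bool × List Bool} (hσ : σ.2.length ≤ N) (v : Vars)
    (r₀ : List Bool) (hi : v.i < bmGuesses Q p) (hr : v.r = r₀.drop (v.i * p.size * bmM Q p * (bmK Q p + 1)))
    (he : v.e = 0) (hx : v.x = 0) (hcnt : v.cnt = 0) (hcj : v.cj = []) (hee : v.ee = 0) (hd : v.d = 0)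
    (hp2i : v.p2i = 0) (hpw : v.pw = 0) (hf1 : v.f1 = false) (hacc : v.acc = 0) (htp : v.tp = 1) (hct : v.ct = [])
    (hbest : v.best ≤ candBound Q p) :
    Impl candProg (bmCandidateC Q p g y r₀ v.i) σ (encSt (mkC Q p g y) v)
      (fun c T' => c ≤ candBound Q p ∧ T' = encSt (mkC Q p g y)
        { v with r := r₀.drop ((v.i + 1) * p.size * bmM Q p * (bmK Q p + 1)), i := v.i + 1,
                 best := bestAfter p g y v.best v.fnd c, fnd := fndAfter p g y v.fnd c })
      (28800 * (N + 1) ^ 5) := by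
  have hp0 := hB.p_pos
  have hp1 := hB.one_lt
  have h1N := hB.one_le_N
  have hlp := hB.len_p
  have h2l : 2 ^ p.size ≤ 2 * p := hB.two_pow_l_le
  have hq2 : bmGuesses Q p ≤ N := hB.two_q_le
  have hiN : v.i ≤ N := hi.le.trans hq2
  have hS : bmSeg Q p ≤ p := by
    unfold bmSeg; have := Nat.div_le_self (p - 1) (2 * bmQ Q p); omega
  have hiS : v.i * bmSeg Q p ≤ 2 * bmQ Q p * bmSeg Q p := Nat.mul_le_mul_right _ (by unfold bmGuesses at hi; omega)
  have hCB : candBound Q p ≤ 4 * p + 2 * bmQ Q p * bmSeg Q p := by unfold candBound; omega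
  have hliS : (encodeNat (v.i * bmSeg Q p)).length ≤ N := hB.lenC _ (by omega)
  have hU5 : (N + 1) ^ 3 ≤ (N + 1) ^ 5 := Nat.pow_le_pow_right (Nat.succ_pos N) (by norm_num)
  -- the start of the descent, machine form and mathematical form
  set w := y * (g ^ (p - 2)) ^ (v.i * bmSeg Q p) % p with hw
  have hwp : w < p := Nat.mod_lt _ hp0
  have hwNF : y * (g ^ (p - 2) % p) ^ (v.i * bmSeg Q p) % p = w := by
    rw [hw, Nat.mul_mod, Nat.pow_mod, Nat.mod_mod, ← Nat.pow_mod, ← Nat.mul_mod]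
  set B := v.i * p.size * bmM Q p * (bmK Q p + 1) with hBdef
  have hBl : B + p.size * bmM Q p * (bmK Q p + 1) = (v.i + 1) * p.size * bmM Q p * (bmK Q p + 1) := by
    rw [hBdef]; ring
  set v₁ : Vars := { v with e := w } with hv₁
  -- the postcondition, as a function of the candidate
  let post : ℕ → Regs (BC ⊕ BV) → Prop := fun c T' => c ≤ candBound Q p ∧ T' = encSt (mkC Q p g y)
    { v with r := r₀.drop ((v.i + 1) * p.size * bmM Q p * (bmK Q p + 1)), i := v.i + 1,
             best := bestAfter p g y v.best v.fnd c, fnd := fndAfter p g y v.fnd c }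
  show Impl candProg _ σ _ post _
  -- before the descent
  have hpre : Runs candPreS.com (st σ (mkC Q p g y) v)
      (qst σ (encSt (mkC Q p g y) { v₁ with ct := List.replicate p.size true })) (3142 * (N + 1) ^ 3) := by
    refine NS.runs_of_eq (N := N) candPreS _ ?_ ?_ ?_
    · simp [candPreS, vv, cc, len_of_le hiN, hB.len_le hS, hliS, hB.len_mod, hlp, hp1, hp0, he, hB.len_lt hB.y_lt,
        hB.l_le]
    · simp [candPreS, vv, cc, hv₁, he, hwNF]
      congr 1; funext r; rcases r with r | r
      · simp
      · cases r <;> simp [hct]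
    · simp [candPreS]
  -- the descent
  have hdesc := impl_descent hB hσ v₁ r₀ B (bmBlocks r₀ p.size (bmM Q p) (bmK Q p) v.i)
    (fun t j => by rw [bmBlocks_eq_blkAt]; congr 1; simp only [bmCoinIdx, hBdef]; ring)
    (by simp [hv₁, hr, hBdef]) (by simpa [hv₁] using hwp) hx hcnt hcj hee hd hp2i hpw hf1 hacc htp hct
  -- after the descent
  have hpost : ∀ (s : ℕ × ℕ × ℕ) (σ' : List Bool × List Bool) (T' : Regs (BC ⊕ BV)),
      (s.2.1 < p ∧ s.2.2 < 2 ^ p.size ∧ T' = encSt (mkC Q p g y)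
        { v₁ with r := r₀.drop (B + p.size * bmM Q p * (bmK Q p + 1)), e := s.2.1, acc := s.2.2, tp := 2 ^ p.size }) →
      ∃ T'', Runs candPostS.com (qst σ' T') (qst σ' T'') (2464 * (N + 1) ^ 3) ∧
        post (s.2.2 + v.i * bmSeg Q p) T'' := by
    rintro ⟨t, e₁, acc₁⟩ σ' T' ⟨he₁, hacc₁, hT'⟩
    simp only at he₁ hacc₁
    subst hT'
    have hcand : acc₁ + v.i * bmSeg Q p ≤ candBound Q p := by unfold candBound; omega
    refine ⟨_, ?_, hcand, rfl⟩
    have hlacc : (encodeNat acc₁).length ≤ N := hB.lenR (by omega)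
    have hlcand : (encodeNat (acc₁ + v.i * bmSeg Q p)).length ≤ N := hB.lenC _ (hcand.trans hCB)
    have hlbest : (encodeNat v.best).length ≤ N := hB.lenC _ (hbest.trans hCB)
    have hl2l : (encodeNat (2 ^ p.size)).length ≤ N := hB.lenR (by omega)
    have hy : y % p = y := Nat.mod_eq_of_lt hB.y_lt
    have hliN1 : (encodeNat v.i).length ≤ N + 1 := (len_of_le hiN).trans N.le_succ
    by_cases hP : g ^ (acc₁ + v.i * bmSeg Q p) % p = y
    · cases hf : v.fnd
      · refine NS.runs_of_eq (N := N) candPostS _ ?_ ?_ ?_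
        · simp [candPostS, vv, cc, hv₁, len_of_le hiN, hB.len_le hS, hlacc, hliS, hlcand, hB.len_lt hB.g_lt, hlp, hp1,
            hB.len_lt hB.y_lt, hP, hf, hlbest, hB.len_lt he₁, hl2l, h1N, hliN1]
        · simp [candPostS, vv, cc, hv₁, hP, hf]
          congr 1; funext r; rcases r with r | r
          · simp
          · cases r <;> simp [bestAfter, fndAfter, hP, hy, hBl, hct, he, hacc, htp]
        · simp [candPostS]
      · refine NS.runs_of_eq (N := N) candPostS _ ?_ ?_ ?_
        · simp [candPostS, vv, cc, hv₁, len_of_le hiN, hB.len_le hS, hlacc, hliS, hlcand, hB.len_lt hB.g_lt, hlp, hp1,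
            hB.len_lt hB.y_lt, hP, hf, hB.len_lt he₁, hl2l, h1N, hliN1]
        · simp [candPostS, vv, cc, hv₁, hP, hf]
          congr 1; funext r; rcases r with r | r
          · simp
          · cases r <;> simp [bestAfter, fndAfter, hP, hy, hBl, hct, he, hacc, htp]
        · simp [candPostS]
    · refine NS.runs_of_eq (N := N) candPostS _ ?_ ?_ ?_
      · simp [candPostS, vv, cc, hv₁, len_of_le hiN, hB.len_le hS, hlacc, hliS, hlcand, hB.len_lt hB.g_lt, hlp, hp1,
          hB.len_lt hB.y_lt, hP, hB.len_mod, hB.len_lt he₁, hl2l, h1N, hliN1]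
      · simp [candPostS, vv, cc, hv₁, hP]
        congr 1; funext r; rcases r with r | r
        · simp
        · cases r <;> simp [bestAfter, fndAfter, hP, hy, hBl, hct, he, hacc, htp]
      · simp [candPostS]
  rw [bmCandidateC_eq]
  refine (impl_runs_seq hpre (impl_bind_pure (post := post)
    (impl_bind_pure (post := fun c => post (c + v.i * bmSeg Q p)) (impl_seq_runs hdesc hpost)
    (fun s T' h => h)) (fun c T' h => h))).mono ?_
  generalize (N + 1) ^ 3 = U at hU5 ⊢
  generalize (N + 1) ^ 5 = W at hU5 ⊢
  omega

end Candidate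

/-! ### The guesses and the output -/

section Guesses

variable {Q : Polynomial ℕ} {p g y N : ℕ}

/-- The first verified candidate of a list (`0` if none). [Blum–Micali 1984, §3.3, proof of
Theorem 3, Step 3] [folklore] -/
def bestOf (p g y : ℕ) (cands : List ℕ) : ℕ := (cands.find? fun c => decide (g ^ c % p = y % p)).getD 0

/-- Whether some candidate of the list is verified. [folklore] -/
def fndOf (p g y : ℕ) (cands : List ℕ) : Bool := (cands.find? fun c => decide (g ^ c % p = y % p)).isSome

/-- No candidates. [folklore] -/
@[simp] theorem bestOf_nil (p g y : ℕ) : bestOf p g y [] = 0 := rfl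

/-- No candidates. [folklore] -/
@[simp] theorem fndOf_nil (p g y : ℕ) : fndOf p g y [] = false := rfl

/-- One more candidate. [folklore] -/
theorem bestOf_append (p g y : ℕ) (cands : List ℕ) (c : ℕ) :
    bestOf p g y (cands ++ [c]) = bestAfter p g y (bestOf p g y cands) (fndOf p g y cands) c := by
  unfold bestOf fndOf bestAfter
  rw [List.find?_append]
  cases h : cands.find? (fun c => decide (g ^ c % p = y % p)) with
  | none => by_cases hc : g ^ c % p = y % p <;> simp [List.find?, hc]
  | some b => by_cases hc : g ^ c % p = y % p <;> simp [hc]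

/-- One more candidate. [folklore] -/
theorem fndOf_append (p g y : ℕ) (cands : List ℕ) (c : ℕ) :
    fndOf p g y (cands ++ [c]) = fndAfter p g y (fndOf p g y cands) c := by
  unfold fndOf fndAfter
  rw [List.find?_append]
  cases h : cands.find? (fun c => decide (g ^ c % p = y % p)) with
  | none => by_cases hc : g ^ c % p = y % p <;> simp [List.find?, hc]
  | some b => simp

/-- The first verified candidate is one of the candidates (or `0`). [folklore] -/
theorem bestOf_le {p g y : ℕ} {cands : List ℕ} {B : ℕ} (h : ∀ c ∈ cands, c ≤ B) : bestOf p g y cands ≤ B := by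
  unfold bestOf
  cases hf : cands.find? (fun c => decide (g ^ c % p = y % p)) with
  | none => simp
  | some b => simpa using h b (List.mem_of_find?_eq_some hf)

/-- The output of the reduction in terms of `bestOf`. [Blum–Micali 1984, §3.3, proof of Theorem 3,
Step 3] [folklore] -/
theorem bmOutput_eq (p g y : ℕ) (cands : List ℕ) : bmOutput p g y cands = encodeNat (bestOf p g y cands % (p - 1)) := rfl

/-- **The guesses loop implements `forEach` of the candidates** over the `2q` guesses, leaving
the first verified candidate in `BEST`. [Blum–Micali 1984, §3.3, proof of Theorem 3]
[cite: BlumMicali1984, Theorem 3 (proof)] -/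
theorem impl_guesses (hB : Bnd Q p g y N) {σ : List Bool × List Bool} (hσ : σ.2.length ≤ N) (v : Vars)
    (hi : v.i = 0) (he : v.e = 0) (hx : v.x = 0) (hcnt : v.cnt = 0) (hcj : v.cj = []) (hee : v.ee = 0) (hd : v.d = 0)
    (hp2i : v.p2i = 0) (hpw : v.pw = 0) (hf1 : v.f1 = false) (hacc : v.acc = 0) (htp : v.tp = 1) (hct : v.ct = [])
    (hbest : v.best = 0) (hfnd : v.fnd = false) (hci : v.ci = []) :
    Impl (loop (ru (Sum.inr .CI)) candProg candProg)
      (OracleComp.forEach (bmCandidateC Q p g y v.r) (List.range (bmGuesses Q p)))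
      σ (encSt (mkC Q p g y) { v with ci := List.replicate (bmGuesses Q p) true })
      (fun cands T' => (∀ c ∈ cands, c ≤ candBound Q p) ∧ T' = encSt (mkC Q p g y)
        { v with r := v.r.drop (bmGuesses Q p * p.size * bmM Q p * (bmK Q p + 1)), i := bmGuesses Q p,
                 best := bestOf p g y cands, fnd := fndOf p g y cands })
      (28803 * (N + 1) ^ 6) := by
  -- the invariant after the candidates `done`
  let inv : List ℕ → Regs (BC ⊕ BV) → Prop := fun done T =>
    (∀ c ∈ done, c ≤ candBound Q p) ∧ T = encSt (mkC Q p g y)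
      { v with r := v.r.drop (done.length * p.size * bmM Q p * (bmK Q p + 1)), i := done.length,
               best := bestOf p g y done, fnd := fndOf p g y done }
  have hC : ∀ done T, inv done T → T (Sum.inr .CI) = [] := fun done T hT => by rw [hT.2]; simp [hci]
  have hbody : ∀ (done : List ℕ) (σ : List Bool × List Bool) (T : Regs (BC ⊕ BV)) (w : List Bool)
      (hd' : done.length < (List.range (bmGuesses Q p)).length), σ.2.length ≤ N → inv done T →
      Impl candProg (bmCandidateC Q p g y v.r ((List.range (bmGuesses Q p))[done.length]))
        σ (Function.update T (Sum.inr .CI) w)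
        (fun c T' => T' (Sum.inr .CI) = w ∧ inv (done ++ [c]) (Function.update T' (Sum.inr .CI) [])) (28800 * (N + 1) ^ 5) := by
    rintro done σ T w hd' hσ ⟨hdone, hT⟩
    subst hT
    simp only [List.getElem_range, update_encSt_CI]
    have hlen : done.length < bmGuesses Q p := by simpa using hd'
    have := impl_candidate hB hσ
      { v with r := v.r.drop (done.length * p.size * bmM Q p * (bmK Q p + 1)), i := done.length,
               best := bestOf p g y done, fnd := fndOf p g y done, ci := w }
      v.r hlen rfl he hx hcnt hcj hee hd hp2i hpw hf1 hacc htp hct (bestOf_le hdone)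
    refine this.weaken fun c T' hT' => ?_
    obtain ⟨hc, hT'⟩ := hT'
    subst hT'
    refine ⟨by simp, ?_, ?_⟩
    · intro c' hc'
      rcases List.mem_append.1 hc' with h | h
      · exact hdone c' h
      · simp at h; subst h; exact hc
    · simp only [update_encSt_CI, List.length_append, List.length_singleton, bestOf_append, fndOf_append, hci]
  have h := impl_forEach (Sum.inr .CI) candProg (bmCandidateC Q p g y v.r) (List.range (bmGuesses Q p))
    inv (28800 * (N + 1) ^ 5) N hC hbody (List.replicate (bmGuesses Q p) true) [] σ (encSt (mkC Q p g y) v)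
    (by simp) hσ ⟨by simp, by congr 1; cases v; simp_all⟩
  simp only [List.length_nil, List.drop_zero, List.nil_append, update_encSt_CI, List.length_replicate] at h
  refine (h.weaken fun bs T' hT' => ⟨hT'.2.1, by rw [hT'.2.2, hT'.1]⟩).mono ?_
  have hl := hB.two_q_le
  have hWN : N + 1 ≤ (N + 1) ^ 5 := by
    calc N + 1 = (N + 1) ^ 1 := (pow_one _).symm
      _ ≤ (N + 1) ^ 5 := Nat.pow_le_pow_right (Nat.succ_pos N) (by norm_num)
  rw [show (N + 1) ^ 6 = (N + 1) ^ 5 * (N + 1) from pow_succ _ _]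
  generalize (N + 1) ^ 5 = W at hWN ⊢
  unfold bmGuesses at hl ⊢
  calc 2 * bmQ Q p * (28800 * W + 2) + 1 ≤ N * (28800 * W + 2) + 1 := by
        have := Nat.mul_le_mul_right (28800 * W + 2) hl; omega
    _ ≤ 28803 * (W * (N + 1)) := by nlinarith

open NS NOp in
/-- Before the guesses: `TP := 1` and load the guess counter with `2q` marks. [folklore] -/
def prologS : NS O :=
  ofList [.const (vv .TP) (encodeNat 1), .add (vv .T1) (cc .Q) (cc .Q), .toUnary (vv .CI) (vv .T1), .clear (vv .T1)]

open NS NOp in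
/-- The output: `BEST := BEST mod (p - 1)`. [Blum–Micali 1984, §3.3, proof of Theorem 3, Step 3]
[folklore] -/
def outS : NS O :=
  ofList [.divMod (vv .T1) (vv .T2) (vv .BEST) (cc .PM), .clear (vv .BEST), .move (vv .T2) (vv .BEST), .clear (vv .T1)]

/-- The body of the reduction behind the guard, after the parameters: prologue, guesses, output.
[Blum–Micali 1984, §3.3, proof of Theorem 3] [folklore] -/
def bodyProg : Com (EReg ⊕ O) := prologS.com ;; (loop (ru (Sum.inr .CI)) candProg candProg ;; outS.com)

/-- The initial variables: only the coins are loaded. [folklore] -/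
def initVars (r : List Bool) : Vars :=
  { r := r, ci := [], i := 0, best := 0, fnd := false, ct := [], e := 0, acc := 0, tp := 0, f1 := false, ee := 0,
    d := 0, p2i := 0, pw := 0, x := 0, cj := [], cnt := 0 }

/-- **The body implements "candidates, then output"**: from the initial variables (coins `r`) and
the constants of the instance, `bodyProg` implements
`forEach (bmCandidateC …) (range 2q) >>= pure ∘ bmOutput p g y`, ending with the output numeral in
`BEST`. [Blum–Micali 1984, §3.3, proof of Theorem 3] [cite: BlumMicali1984, Theorem 3 (proof)] -/
theorem impl_body (hB : Bnd Q p g y N) {σ : List Bool × List Bool} (hσ : σ.2.length ≤ N) (r : List Bool) :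
    Impl bodyProg
      (OracleComp.bind (OracleComp.forEach (bmCandidateC Q p g y r) (List.range (bmGuesses Q p)))
        fun cands => OracleComp.pure (bmOutput p g y cands))
      σ (encSt (mkC Q p g y) (initVars r))
      (fun b T' => ∃ v : Vars, T' = encSt (mkC Q p g y) v ∧ b = encodeNat v.best ∧ v.best < p)
      (29300 * (N + 1) ^ 6) := by
  have hp0 := hB.p_pos
  have hp1 := hB.one_lt
  have h1N := hB.one_le_N
  have hq := hB.q_le
  have h2q := hB.two_q_le
  have hU6 : (N + 1) ^ 3 ≤ (N + 1) ^ 6 := Nat.pow_le_pow_right (Nat.succ_pos N) (by norm_num)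
  have hCB : candBound Q p ≤ 4 * p + 2 * bmQ Q p * bmSeg Q p := by unfold candBound; omega
  set v₁ : Vars := { initVars r with tp := 1 } with hv₁
  -- the prologue
  have hpro : Runs prologS.com (st σ (mkC Q p g y) (initVars r))
      (qst σ (encSt (mkC Q p g y) { v₁ with ci := List.replicate (bmGuesses Q p) true })) (114 * (N + 1) ^ 3) := by
    have hl2q : (encodeNat (bmQ Q p + bmQ Q p)).length ≤ N := len_of_le (by omega)
    refine NS.runs_of_eq (N := N) prologS _ ?_ ?_ ?_
    · simp [prologS, vv, cc, initVars, h1N, len_of_le hq, hl2q]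
      omega
    · simp [prologS, vv, cc, initVars, hv₁, bmGuesses, two_mul]
      congr 1; funext r; rcases r with r | r
      · simp
      · cases r <;> simp
    · simp [prologS]
  -- the guesses
  have hg := impl_guesses hB hσ v₁ rfl rfl rfl rfl rfl rfl rfl rfl rfl rfl rfl rfl rfl rfl rfl rfl
  rw [show v₁.r = r from rfl] at hg
  -- the output
  have hout : ∀ (cands : List ℕ) (σ' : List Bool × List Bool) (T' : Regs (BC ⊕ BV)),
      ((∀ c ∈ cands, c ≤ candBound Q p) ∧ T' = encSt (mkC Q p g y)
        { v₁ with r := v₁.r.drop (bmGuesses Q p * p.size * bmM Q p * (bmK Q p + 1)), i := bmGuesses Q p,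
                  best := bestOf p g y cands, fnd := fndOf p g y cands }) →
      ∃ T'', Runs outS.com (qst σ' T') (qst σ' T'') (364 * (N + 1) ^ 3) ∧
        ∃ v : Vars, T'' = encSt (mkC Q p g y) v ∧ bmOutput p g y cands = encodeNat v.best ∧ v.best < p := by
    rintro cands σ' T' ⟨hc, hT'⟩
    subst hT'
    have hb : bestOf p g y cands ≤ candBound Q p := bestOf_le hc
    have hlb : (encodeNat (bestOf p g y cands)).length ≤ N := hB.lenC _ (hb.trans hCB)
    have hlq : (encodeNat (bestOf p g y cands / (p - 1))).length ≤ N :=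
      (Brick.length_encodeNat_mono (Nat.div_le_self _ _)).trans hlb
    have hmod : bestOf p g y cands % (p - 1) < p := lt_of_lt_of_le (Nat.mod_lt _ (by omega)) (Nat.sub_le p 1)
    let vf : Vars :=
      { v₁ with
        r := v₁.r.drop (bmGuesses Q p * p.size * bmM Q p * (bmK Q p + 1))
        i := bmGuesses Q p
        best := bestOf p g y cands % (p - 1)
        fnd := fndOf p g y cands }
    refine ⟨qst σ' (encSt (mkC Q p g y) vf) |> fun x => encSt (mkC Q p g y) vf, ?_, vf, rfl, bmOutput_eq p g y cands, hmod⟩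
    refine NS.runs_of_eq (N := N) outS _ ?_ ?_ ?_
    · simp [outS, vv, cc, hv₁, initVars, hlb, hB.len_le (Nat.sub_le p 1), hlq, hB.len_lt hmod]
      omega
    · simp [outS, vv, cc, hv₁, initVars]
      congr 1; funext r; rcases r with r | r
      · simp
      · cases r <;> simp [vf, hv₁, initVars]
    · simp [outS]
  refine (impl_runs_seq hpro (impl_bind_pure
    (post := fun b T' => ∃ v : Vars, T' = encSt (mkC Q p g y) v ∧ b = encodeNat v.best ∧ v.best < p)
    (impl_seq_runs hg hout) (fun cands T' h => h))).mono ?_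
  generalize (N + 1) ^ 3 = U at hU6 ⊢
  generalize (N + 1) ^ 6 = W at hU6 ⊢
  omega

end Guesses

end BMMachine
end Literature.Computability.Cryptography
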